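/-
b2b-lace packet, TAIL-BOUND ANALYST gen 11 (unit `b2b-lace-tail-g11`).  (S2b)-IMPR TABLE-SIDE KIT (T2)+(T3): the cell-sup step for the
PLAIN simple-random-walk integrals `I_{n,l}(x)` and for the D80 shift sums `S_{p,l}(x) = Σ_ι (I_{p,l}(x+2e_ι) + I_{p,l}(x−2e_ι))` over the
cell `‖x‖₁ ≥ 2 ⊇ 𝒳 = {‖x‖₂ > 1}` — the two `x`-dependent quantities of the true `IM` column (`NobleF3TrueTables.srwTrueIM`) that no cell-sup
module of the tree treats (`SrwIntegralTUCellSup`: `T`, `U`, `K`; `SrwIntegralSortedMonotone` §5: `W`, `L`, `K`; `MeanFieldD11FimSup`: `𝒥`).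
`d`-generic; additive; no numeral of any dimension; nothing here is a cited hypothesis — every statement is proved.
-/
import Literature.Probability.FitznerVanDerHofstad2017.SrwIntegralSortedMonotone
import Literature.Probability.FitznerVanDerHofstad2017.SrwIntegralB3Transport
import Literature.Probability.FitznerVanDerHofstad2017.SrwIntegralMassive
import Literature.Probability.FitznerVanDerHofstad2017.SrwIntegralJStep
import Literature.Probability.FitznerVanDerHofstad2017.SrwOrbitPairLaw
import HarnessLib

/-!
# The cell-sup step for `I_{n,l}(x)` and for the shift sums `S_{p,l}(x)` (`‖x‖₁ ≥ 2`, `𝒳`)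

[NoBLE17] R. Fitzner, R. van der Hofstad, *Generalized approach to the non-backtracking lace expansion*, PTRF **169** (2017)
1041–1119, Lemma 5.1 p. 1093 and §3.3.5 (3.30), (3.58), (3.87):

> Lemma 5.1: "for all `n ≥ 1`, `x ↦ I_{n,l}(x)` is monotone decreasing in each `|x_ι|`";
> (3.87): "`f₃(z) ≤ max_{{n,l,S} ∈ 𝒮} sup_{x ∈ S} (Σ_{i=1}^5 BoundH[i](n,l,x)) / c_{n,l,S}`", with (p. 1079) "the supremum over `S` is
> attained at one of the lowest-order points of `S`" — printed for the tables `T`, `U`, `K`, `𝒥`; the Step-1 quantities `I_{m+3,l}(x)` and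
> `Σ_ι I_{m+3,l}(x ± 2e_ι)` ((3.58)/(3.30), DIVERGENCE D80 of the b2b-lace packet) are read at the same cells.

[HS92b] T. Hara, G. Slade, Rev. Math. Phys. **4** (1992) 235–327, App. B, Lemma B.3 (monotonicity of `I_{n,0}` in each `|x_μ|`).

## What is here (all proved, `d`-generic)

§1 Abstract tools for a `W_d`-invariant (`SpInvariant`) table `F : ℤ^d → ℝ` that is non-increasing under coordinatewise domination of
   absolute values (`AbsMonotone`, [NoBLE17] Lemma 5.1 shape): `sortedAntitone_of_absMonotone`; domination by one / two pinned coordinates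
   (`le_axisVec_of_absMonotone`, `le_axisVec_add_axisVec_of_absMonotone`); position-independence of the one- and two-point values
   (`axisVec_eq_of_spInvariant`, `axisVec_neg_eq_of_spInvariant`, `axisVec_add_axisVec_eq_of_spInvariant`).
§2 `I_{n,l}` on the cell `‖x‖₁ ≥ 2` (`n ≥ 1`, `d ≥ 2n+1`): **`srwI_le_max_of_two_le_sum_abs`** —
   `I_{n,l}(x) ≤ max (I_{n,l}(2e₁), I_{n,l}(e₁+e₂))` (the two minimal profiles; `SrwIntegralSortedMonotone.le_of_nodeBounds_two` with the
   `1^r`-family collapsed by coordinatewise monotonicity), and on `𝒳` (`srwI_le_max_of_mem_calX`, `srwI_le_of_nodeBounds_calX`).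
§3 The shift sums.  `S(x) := Σ_ι (F(x+2e_ι) + F(x−2e_ι))` is NOT monotone in `|x_μ|` (`|x_μ ± 2|` is not), so its cell sup is not a
   two-node affair; the exact elementary reduction proved here (`shift2Sum_le_max_of_two_le_sum_abs`): for `‖x‖₁ ≥ 2`,
   `S(x) ≤ max (F(0) + F(4e₁) + (2d−2)·F(2e₁+2e₂)) (4·F(e₁) + (2d−4)·F(e₁+e₂))`
   — the first entry is `S(±2e_κ)` exactly (one shifted point is the origin), the second bounds every other `x` of the cell (support `≥ 2`:
   at most the two shifts along a support axis can lose a support coordinate; `x = a e_κ`, `|a| ≥ 3`: no shifted point is `0`).  Also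
   `shift2Sum_zero` (`S(0) = 2d·F(2e₁)`) and the blanket `shift2Sum_le_card_mul` (`S(x) ≤ 2d·F(0)`).  Instantiated for `F = I_{p,l}`
   (`p ≥ 1`, `d ≥ 2p+1`): **`srwIShift2_le_max_of_two_le_sum_abs`**, `srwIShift2_le_max_of_mem_calX`, `srwIShift2_le_of_nodeBounds_calX`,
   `srwIShift2_zero`, `srwIShift2_le_srwI_zero_mul`.

USE (b2b-lace, `NobleF3TrueTables` §4): the per-entry reductions `srwTrue_IM_natCast_le` / `srwTrue_IM_negOne_le` ask, uniformly in `x` over a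
cell, for `I_{m+3,l}(x) ≤ d α̲ t` and `(ᾱ−1) S_{m+3,l}(x) ≤ 2d² t` (and the `m = −1` analogues); by §2–§3 these follow from finitely many NODE
VALUES `I_{p,l}(0), I(e₁), I(2e₁), I(4e₁), I(e₁+e₂), I(2e₁+2e₂)` — certified-numerics territory (`SrwSeedCert*`, `MeanFieldD11Stage1TabsI*`).
Node vocabulary as in `SrwIntegralSortedMonotone` / `SrwIntegralTUCellSup`: `vecOfParts d [a]` (`= a e₁`), `vecOfParts d [2,2]`, `classVec d 2 0`
(`= e₁+e₂`).

## What is NOT here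
No dimension, no table, no numeric value; no statement about `d ≠` anything.
-/

namespace Literature.Probability.FitznerVanDerHofstad2017

open Finset Real
open Literature.Barriers.CriticalPhenomena Literature.Probability.LatticeModels

variable {d : ℕ}

/-! ### §1  Abstract tools: domination and position-independence -/

/-- Coordinatewise `|·|`-monotonicity implies antitonicity in the sorted order. [folklore] -/
theorem sortedAntitone_of_absMonotone {F : (Fin d → ℤ) → ℝ} (hF : AbsMonotone F) : SortedAntitone F :=
  fun x z _ hx0 _ hz0 => hF (x + z) x fun μ => by
    rw [Pi.add_apply, abs_of_nonneg (hx0 μ), abs_of_nonneg (add_nonneg (hx0 μ) (hz0 μ))]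
    linarith [hz0 μ]

/-- One pinned coordinate: `|a| ≤ |z_i|` gives `F z ≤ F (a e_i)`. [cite: FitznerVanDerHofstad2016NoBLE, Lemma 5.1 p. 1093] -/
theorem le_axisVec_of_absMonotone {F : (Fin d → ℤ) → ℝ} (hF : AbsMonotone F) (i : Fin d) (a : ℤ)
    (z : Fin d → ℤ) (ha : |a| ≤ |z i|) : F z ≤ F (axisVec i a) :=
  hF z (axisVec i a) fun μ => by
    rw [axisVec_apply']
    split_ifs with h
    · rw [h]; exact ha
    · rw [abs_zero]; exact abs_nonneg _

/-- Two pinned coordinates: `|a| ≤ |z_i|`, `|b| ≤ |z_j|` (`i ≠ j`) give `F z ≤ F (a e_i + b e_j)`.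
[cite: FitznerVanDerHofstad2016NoBLE, Lemma 5.1 p. 1093] -/
theorem le_axisVec_add_axisVec_of_absMonotone {F : (Fin d → ℤ) → ℝ} (hF : AbsMonotone F) {i j : Fin d}
    (hij : i ≠ j) (a b : ℤ) (z : Fin d → ℤ) (ha : |a| ≤ |z i|) (hb : |b| ≤ |z j|) :
    F z ≤ F (axisVec i a + axisVec j b) :=
  hF z _ fun μ => by
    rw [Pi.add_apply, axisVec_apply', axisVec_apply']
    by_cases hi : μ = i
    · subst hi
      rw [if_pos rfl, if_neg hij, add_zero]; exact ha
    · rw [if_neg hi, zero_add]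
      by_cases hj : μ = j
      · subst hj
        rw [if_pos rfl]; exact hb
      · rw [if_neg hj, abs_zero]; exact abs_nonneg _

/-- A pure permutation acts by `(σ · x)_μ = x_{σ μ}`. [folklore] -/
theorem spAct_perm_one_apply (σ : Equiv.Perm (Fin d)) (x : Fin d → ℤ) (μ : Fin d) :
    spAct (σ, fun _ => (1 : ℤˣ)) x μ = x (σ μ) := by
  rw [spAct_apply, Units.val_one, one_mul]

/-- `F (a e_i)` does not depend on the axis `i`. [cite: FitznerVanDerHofstad2016NoBLE, (3.35) p. 1071] -/
theorem axisVec_eq_of_spInvariant {F : (Fin d → ℤ) → ℝ} (hI : SpInvariant F) (i i' : Fin d) (a : ℤ) :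
    F (axisVec i a) = F (axisVec i' a) := by
  have h := hI (Equiv.swap i' i, fun _ => (1 : ℤˣ)) (axisVec i' a)
  rw [spAct_swap_axisVec, Units.val_one, one_mul] at h
  exact h

/-- `F (−a e_i) = F (a e_i)`. [cite: FitznerVanDerHofstad2016NoBLE, (3.35) p. 1071] -/
theorem axisVec_neg_eq_of_spInvariant {F : (Fin d → ℤ) → ℝ} (hI : SpInvariant F) (i : Fin d) (a : ℤ) :
    F (axisVec i (-a)) = F (axisVec i a) := by
  have h := hI (Equiv.swap i i, fun _ => (-1 : ℤˣ)) (axisVec i a)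
  rw [spAct_swap_axisVec, Units.val_neg, Units.val_one, neg_one_mul] at h
  exact h

/-- `F (a e_i + b e_j)` (`i ≠ j`) does not depend on the ordered pair of distinct axes.
[cite: FitznerVanDerHofstad2016NoBLE, (3.35) p. 1071] -/
theorem axisVec_add_axisVec_eq_of_spInvariant {F : (Fin d → ℤ) → ℝ} (hI : SpInvariant F)
    {i j i' j' : Fin d} (hij : i ≠ j) (hij' : i' ≠ j') (a b : ℤ) :
    F (axisVec i a + axisVec j b) = F (axisVec i' a + axisVec j' b) := by
  obtain ⟨ν, hνi, hνj⟩ := exists_perm_pair hij hij'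
  have key : spAct (ν, fun _ => (1 : ℤˣ)) (axisVec i a + axisVec j b) = axisVec i' a + axisVec j' b := by
    funext μ
    rw [spAct_perm_one_apply, Pi.add_apply, Pi.add_apply, axisVec_apply', axisVec_apply', axisVec_apply',
      axisVec_apply', ← hνi, ← hνj]
    simp only [EmbeddingLike.apply_eq_iff_eq]
  rw [← key, hI]

/-- `F(1^{r'}) ≤ F(1^r)` for `r ≤ r'` under coordinatewise monotonicity. [cite: FitznerVanDerHofstad2016NoBLE, Lemma 5.1 p. 1093] -/
theorem classVec_le_classVec_of_absMonotone {F : (Fin d → ℤ) → ℝ} (hF : AbsMonotone F) {r r' : ℕ} (h : r ≤ r') :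
    F (classVec d r' 0) ≤ F (classVec d r 0) :=
  hF _ _ fun μ => by
    rw [classVec_zero_right_apply, classVec_zero_right_apply]
    by_cases h1 : (μ : ℕ) < r
    · simp only [if_pos h1, if_pos (lt_of_lt_of_le h1 h), le_refl]
    · rw [if_neg h1, abs_zero]; exact abs_nonneg _

/-- `Σ_μ |(a e_ι)_μ| = |a|`. [folklore] -/
theorem sum_abs_axisVec (ι : Fin d) (a : ℤ) : ∑ μ, |axisVec ι a μ| = |a| := by
  have h : ∀ μ, |axisVec ι a μ| = axisVec ι |a| μ := fun μ => by
    rw [axisVec_apply', axisVec_apply']; split_ifs <;> simp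
  simp_rw [h]
  exact sum_axisVec (Fin.pos ι) ι |a|

/-- `a e_i + b e_i = (a+b) e_i`. [folklore] -/
theorem axisVec_add_axisVec_same (i : Fin d) (a b : ℤ) : axisVec i a + axisVec i b = axisVec i (a + b) := by
  funext μ; rw [Pi.add_apply, axisVec_apply', axisVec_apply', axisVec_apply']; split_ifs <;> simp

/-- `0 e_i = 0`. [folklore] -/
theorem axisVec_zero_right (i : Fin d) : axisVec i 0 = 0 := by
  funext μ; rw [axisVec_apply']; split_ifs <;> rfl

/-- `(x + a e_ι)_μ = x_μ` off the axis. [folklore] -/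
theorem add_axisVec_apply_of_ne (x : Fin d → ℤ) {ι μ : Fin d} (h : μ ≠ ι) (a : ℤ) : (x + axisVec ι a) μ = x μ := by
  rw [Pi.add_apply, axisVec_apply', if_neg h, add_zero]

/-- `(x + a e_ι)_ι = x_ι + a`. [folklore] -/
theorem add_axisVec_apply_self (x : Fin d → ℤ) (ι : Fin d) (a : ℤ) : (x + axisVec ι a) ι = x ι + a := by
  rw [Pi.add_apply, axisVec_apply', if_pos rfl]

/-- The node `a e₁` in the `vecOfParts` vocabulary. [folklore] -/
theorem vecOfParts_single_eq_axisVec (hd : 1 ≤ d) (a : ℕ) : vecOfParts d [a] = axisVec ⟨0, hd⟩ (a : ℤ) := by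
  funext μ
  rw [vecOfParts_single_apply, axisVec_apply']
  simp only [Fin.ext_iff]

/-- The node `a e₁ + b e₂` in the `vecOfParts` vocabulary. [folklore] -/
theorem vecOfParts_pair_eq_axisVec (hd : 2 ≤ d) (a b : ℕ) :
    vecOfParts d [a, b] = axisVec ⟨0, by omega⟩ (a : ℤ) + axisVec ⟨1, by omega⟩ (b : ℤ) := by
  funext μ
  rw [vecOfParts_pair_apply, Pi.add_apply, axisVec_apply', axisVec_apply']
  simp only [Fin.ext_iff]
  by_cases h0 : (μ : ℕ) = 0
  · simp [h0]
  · by_cases h1 : (μ : ℕ) = 1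
    · simp [h1]
    · simp [h0, h1]

/-- The node `e₁ + e₂ = 1^2` in the `classVec` vocabulary. [folklore] -/
theorem classVec_two_zero_eq_axisVec (hd : 2 ≤ d) :
    classVec d 2 0 = axisVec ⟨0, by omega⟩ 1 + axisVec ⟨1, by omega⟩ 1 := by
  funext μ
  rw [classVec_zero_right_apply, Pi.add_apply, axisVec_apply', axisVec_apply']
  simp only [Fin.ext_iff]
  by_cases h0 : (μ : ℕ) = 0
  · simp [h0]
  · by_cases h1 : (μ : ℕ) = 1
    · simp [h1]
    · rw [if_neg (by omega), if_neg h0, if_neg h1, add_zero]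

/-! ### §2  `I_{n,l}` on the cells `‖x‖₁ ≥ 2` and `𝒳` -/

/-- `I_{n,l}` is `W_d`-invariant. [cite: FitznerVanDerHofstad2016NoBLE, (3.35) p. 1071] -/
theorem spInvariant_srwI (n l : ℕ) : SpInvariant (srwI d n l) := fun τ x => srwI_spAct n l τ x

/-- `I_{n,l}` is sorted-antitone (`n ≥ 1`, `d ≥ 2n+1`). [cite: FitznerVanDerHofstad2016NoBLE, Lemma 5.1 p. 1093] -/
theorem sortedAntitone_srwI {n : ℕ} (hn : 1 ≤ n) (hd : 2 * n + 1 ≤ d) (l : ℕ) : SortedAntitone (srwI d n l) :=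
  sortedAntitone_of_absMonotone (absMonotone_srwI hn hd l)

/-- **Cell `‖x‖₁ ≥ 2` for `I_{n,l}`: the two nodes `2e₁`, `e₁+e₂`.**  For `n ≥ 1`, `d ≥ 2n+1` and `‖x‖₁ ≥ 2`,
`I_{n,l}(x) ≤ max (I_{n,l}(2e₁)) (I_{n,l}(e₁+e₂))` (the `1^r`-family of `le_of_nodeBounds_two` collapses to `r = 2` by Lemma 5.1).
[cite: FitznerVanDerHofstad2016NoBLE, Lemma 5.1 p. 1093; §3.3.5 (3.87) p. 1079] -/
theorem srwI_le_max_of_two_le_sum_abs {n : ℕ} (hn : 1 ≤ n) (hd : 2 * n + 1 ≤ d) (l : ℕ) (x : Fin d → ℤ)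
    (hx : 2 ≤ ∑ j, |x j|) :
    srwI d n l x ≤ max (srwI d n l (vecOfParts d [2])) (srwI d n l (classVec d 2 0)) :=
  le_of_nodeBounds_two (srwI d n l) (spInvariant_srwI n l) (sortedAntitone_srwI hn hd l) _ (le_max_left _ _)
    (fun _ hr _ => (classVec_le_classVec_of_absMonotone (absMonotone_srwI hn hd l) hr).trans (le_max_right _ _)) x hx

/-- **Cell `𝒳 = {‖x‖₂ > 1}` for `I_{n,l}`** (`𝒳 ⊆ {‖x‖₁ ≥ 2}`): `I_{n,l}(x) ≤ max (I_{n,l}(2e₁)) (I_{n,l}(e₁+e₂))`.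
[cite: FitznerVanDerHofstad2016NoBLE, Lemma 5.1 p. 1093; §3.3.5 (3.87) p. 1079] -/
theorem srwI_le_max_of_mem_calX {n : ℕ} (hn : 1 ≤ n) (hd : 2 * n + 1 ≤ d) (l : ℕ) {x : Fin d → ℤ}
    (hx : x ∈ calX d) :
    srwI d n l x ≤ max (srwI d n l (vecOfParts d [2])) (srwI d n l (classVec d 2 0)) :=
  srwI_le_max_of_two_le_sum_abs hn hd l x (two_le_sum_abs_of_mem_calX x hx)

/-- **Node-bound form on `𝒳`**: `I_{n,l}(2e₁) ≤ B` and `I_{n,l}(e₁+e₂) ≤ B` give `I_{n,l}(x) ≤ B` for every `x ∈ 𝒳`.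
[cite: FitznerVanDerHofstad2016NoBLE, Lemma 5.1 p. 1093; §3.3.5 (3.87) p. 1079] -/
theorem srwI_le_of_nodeBounds_calX {n : ℕ} (hn : 1 ≤ n) (hd : 2 * n + 1 ≤ d) (l : ℕ) {B : ℝ}
    (h2 : srwI d n l (vecOfParts d [2]) ≤ B) (h11 : srwI d n l (classVec d 2 0) ≤ B)
    {x : Fin d → ℤ} (hx : x ∈ calX d) : srwI d n l x ≤ B :=
  (srwI_le_max_of_mem_calX hn hd l hx).trans (max_le h2 h11)

/-! ### §3  The shift sums `S(x) = Σ_ι (F(x+2e_ι) + F(x−2e_ι))` -/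

/-- The shift sum of a table `F`: `S_F(x) := Σ_ι (F(x + 2e_ι) + F(x − 2e_ι))`. [cite: FitznerVanDerHofstad2016NoBLE, (3.30) p. 1070] -/
def shift2Sum (F : (Fin d → ℤ) → ℝ) (x : Fin d → ℤ) : ℝ :=
  ∑ ι : Fin d, (F (x + axisVec ι 2) + F (x - axisVec ι 2))

/-- `S_{p,l} = S_{I_{p,l}}`. [cite: FitznerVanDerHofstad2016NoBLE, (3.30) p. 1070] -/
theorem srwIShift2_eq_shift2Sum (p l : ℕ) (x : Fin d → ℤ) : srwIShift2 d p l x = shift2Sum (srwI d p l) x := rfl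

/-- Blanket bound: `S_F(x) ≤ 2d · F(0)` when `F ≤ F(0)` everywhere. [folklore] -/
theorem shift2Sum_le_card_mul {F : (Fin d → ℤ) → ℝ} (h0 : ∀ z, F z ≤ F 0) (x : Fin d → ℤ) :
    shift2Sum F x ≤ 2 * d * F 0 := by
  unfold shift2Sum
  calc ∑ ι : Fin d, (F (x + axisVec ι 2) + F (x - axisVec ι 2)) ≤ ∑ _ι : Fin d, (2 * F 0) :=
        Finset.sum_le_sum fun ι _ => by linarith [h0 (x + axisVec ι 2), h0 (x - axisVec ι 2)]
    _ = 2 * d * F 0 := by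
        rw [Finset.sum_const, Finset.card_univ, Fintype.card_fin, nsmul_eq_mul]; ring

/-- `S_F(0) = 2d · F(2e₁)` for `W_d`-invariant `F`. [cite: FitznerVanDerHofstad2016NoBLE, (3.30), (3.35)] -/
theorem shift2Sum_zero {F : (Fin d → ℤ) → ℝ} (hI : SpInvariant F) (hd : 1 ≤ d) :
    shift2Sum F 0 = 2 * d * F (vecOfParts d [2]) := by
  unfold shift2Sum
  have h : ∀ ι : Fin d, F (0 + axisVec ι 2) + F (0 - axisVec ι 2) = 2 * F (vecOfParts d [2]) := by
    intro ι
    rw [zero_add, zero_sub, ← axisVec_neg, axisVec_neg_eq_of_spInvariant hI,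
      vecOfParts_single_eq_axisVec hd, axisVec_eq_of_spInvariant hI ι ⟨0, hd⟩]
    push_cast; ring
  simp_rw [h]
  rw [Finset.sum_const, Finset.card_univ, Fintype.card_fin, nsmul_eq_mul]; ring

/-- Sum of a constant plus one bump over `Fin d`. [folklore] -/
theorem sum_const_add_ite (κ : Fin d) (b e : ℝ) :
    ∑ ι : Fin d, (b + if ι = κ then e else 0) = d * b + e := by
  rw [Finset.sum_add_distrib, Finset.sum_const, Finset.card_univ, Fintype.card_fin, nsmul_eq_mul,
    Finset.sum_ite_eq' Finset.univ κ (fun _ => e), if_pos (Finset.mem_univ _)]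

/-- Sum of a constant plus two bumps over `Fin d`. [folklore] -/
theorem sum_const_add_ite_add_ite (i j : Fin d) (b e : ℝ) :
    ∑ ι : Fin d, (b + (if ι = i then e else 0) + (if ι = j then e else 0)) = d * b + e + e := by
  rw [Finset.sum_add_distrib, sum_const_add_ite, Finset.sum_ite_eq' Finset.univ j (fun _ => e),
    if_pos (Finset.mem_univ _)]

/-- **The shift sum on the cell `‖x‖₁ ≥ 2`.**  For `F` `W_d`-invariant and coordinatewise `|·|`-monotone, `d ≥ 2`, `‖x‖₁ ≥ 2`:
`S_F(x) ≤ max (F(0) + F(4e₁) + (2d−2)·F(2e₁+2e₂)) (4·F(e₁) + (2d−4)·F(e₁+e₂))`.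
The first entry is the value at `x = ±2e_κ` (the shifted point `x ∓ 2e_κ` is the origin, `x ± 2e_κ = ±4e_κ`, the other `2d−2` points are
`±2e_κ ± 2e_ι`); the second bounds every other point of the cell: if the support of `x` has two elements `i ≠ j`, a shift along `ι ∉ {i,j}`
keeps both (value `≤ F(e₁+e₂)`), a shift along `i` or `j` keeps the other (value `≤ F(e₁)`); if `x = a e_κ`, `|a| ≥ 3`, the two shifts along
`κ` are `(a±2) e_κ ≠ 0` (`≤ F(e₁)`) and the others pin `κ` and `ι` (`≤ F(e₁+e₂) ≤ F(e₁)`).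
[cite: FitznerVanDerHofstad2016NoBLE, Lemma 5.1 p. 1093; (3.30) p. 1070; §3.3.5 (3.87) p. 1079] -/
theorem shift2Sum_le_max_of_two_le_sum_abs {F : (Fin d → ℤ) → ℝ} (hF : AbsMonotone F) (hI : SpInvariant F)
    (hd : 2 ≤ d) (x : Fin d → ℤ) (hx : 2 ≤ ∑ j, |x j|) :
    shift2Sum F x ≤ max (F 0 + F (vecOfParts d [4]) + (2 * d - 2) * F (vecOfParts d [2, 2]))
      (4 * F (vecOfParts d [1]) + (2 * d - 4) * F (classVec d 2 0)) := by
  -- canonical axes and node values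
  set i₀ : Fin d := ⟨0, by omega⟩ with hi₀
  set i₁ : Fin d := ⟨1, by omega⟩ with hi₁
  have h01 : i₀ ≠ i₁ := by simp [hi₀, hi₁, Fin.ext_iff]
  rw [vecOfParts_single_eq_axisVec (by omega : 1 ≤ d) 4, vecOfParts_single_eq_axisVec (by omega : 1 ≤ d) 1,
    vecOfParts_pair_eq_axisVec hd 2 2, classVec_two_zero_eq_axisVec hd]
  push_cast
  set f0 := F 0 with hf0
  set f4 := F (axisVec i₀ 4) with hf4
  set f22 := F (axisVec i₀ 2 + axisVec i₁ 2) with hf22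
  set f1 := F (axisVec i₀ 1) with hf1
  set f11 := F (axisVec i₀ 1 + axisVec i₁ 1) with hf11
  have hf11_le : f11 ≤ f1 :=
    le_axisVec_of_absMonotone hF i₀ 1 _ (by rw [add_axisVec_apply_of_ne _ h01, axisVec_apply', if_pos rfl])
  -- generic term bounds
  have hone : ∀ (z : Fin d → ℤ) (j : Fin d), z j ≠ 0 → F z ≤ f1 := fun z j hz =>
    (le_axisVec_of_absMonotone hF j 1 z (by rw [abs_one]; exact Int.one_le_abs hz)).trans
      (axisVec_eq_of_spInvariant hI j i₀ 1).le
  have htwo : ∀ (z : Fin d → ℤ) (i j : Fin d), i ≠ j → z i ≠ 0 → z j ≠ 0 → F z ≤ f11 := fun z i j hij hi hj =>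
    (le_axisVec_add_axisVec_of_absMonotone hF hij 1 1 z (by rw [abs_one]; exact Int.one_le_abs hi)
      (by rw [abs_one]; exact Int.one_le_abs hj)).trans (axisVec_add_axisVec_eq_of_spInvariant hI hij h01 1 1).le
  have hx0 : x ≠ 0 := by
    rintro rfl
    simp at hx
  unfold shift2Sum
  rcases two_le_suppCount_or_axis x hx0 with h2 | ⟨κ, a, ha0, rfl⟩
  · -- support of size ≥ 2: two support axes `i ≠ j`
    have h2' : 1 < (univ.filter fun μ : Fin d => x μ ≠ 0).card := h2
    obtain ⟨i, hi, j, hj, hij⟩ := Finset.one_lt_card.mp h2'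
    have hxi : x i ≠ 0 := (Finset.mem_filter.mp hi).2
    have hxj : x j ≠ 0 := (Finset.mem_filter.mp hj).2
    have hterm : ∀ ι : Fin d, F (x + axisVec ι 2) + F (x - axisVec ι 2) ≤
        2 * f11 + (if ι = i then 2 * (f1 - f11) else 0) + (if ι = j then 2 * (f1 - f11) else 0) := by
      intro ι
      by_cases hιi : ι = i
      · subst hιi
        rw [if_pos rfl, if_neg hij]
        have ha : F (x + axisVec ι 2) ≤ f1 := hone _ j (by rwa [add_axisVec_apply_of_ne x (Ne.symm hij)])
        have hb : F (x - axisVec ι 2) ≤ f1 :=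
          hone _ j (by rwa [sub_axisVec_eq_add, add_axisVec_apply_of_ne x (Ne.symm hij)])
        linarith
      · by_cases hιj : ι = j
        · subst hιj
          rw [if_neg hιi, if_pos rfl]
          have ha : F (x + axisVec ι 2) ≤ f1 := hone _ i (by rwa [add_axisVec_apply_of_ne x hij])
          have hb : F (x - axisVec ι 2) ≤ f1 :=
            hone _ i (by rwa [sub_axisVec_eq_add, add_axisVec_apply_of_ne x hij])
          linarith
        · rw [if_neg hιi, if_neg hιj]
          have ha : F (x + axisVec ι 2) ≤ f11 := htwo _ i j hij
            (by rwa [add_axisVec_apply_of_ne x (Ne.symm hιi)]) (by rwa [add_axisVec_apply_of_ne x (Ne.symm hιj)])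
          have hb : F (x - axisVec ι 2) ≤ f11 := htwo _ i j hij
            (by rwa [sub_axisVec_eq_add, add_axisVec_apply_of_ne x (Ne.symm hιi)])
            (by rwa [sub_axisVec_eq_add, add_axisVec_apply_of_ne x (Ne.symm hιj)])
          linarith
    refine le_max_of_le_right ((Finset.sum_le_sum fun ι _ => hterm ι).trans ?_)
    rw [sum_const_add_ite_add_ite]
    linarith
  · -- `x = a e_κ`, `a ≠ 0`, `|a| ≥ 2`
    rw [sum_abs_axisVec] at hx
    rcases (show |a| = 2 ∨ 3 ≤ |a| by omega) with h2 | h3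
    · -- `|a| = 2`: the value `F 0 + F(4e₁) + (2d−2) F(2e₁+2e₂)`
      have hterm : ∀ ι : Fin d, F (axisVec κ a + axisVec ι 2) + F (axisVec κ a - axisVec ι 2) ≤
          2 * f22 + (if ι = κ then f0 + f4 - 2 * f22 else 0) := by
        intro ι
        by_cases hικ : ι = κ
        · subst hικ
          rw [if_pos rfl, sub_axisVec_eq_add, axisVec_add_axisVec_same, axisVec_add_axisVec_same]
          rcases (abs_eq (by norm_num : (0 : ℤ) ≤ 2)).mp h2 with ha | ha
          · rw [ha, show (2 : ℤ) + 2 = 4 by norm_num, show (2 : ℤ) + -2 = 0 by norm_num, axisVec_zero_right,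
              axisVec_eq_of_spInvariant hI ι i₀ 4]
            linarith
          · rw [ha, show (-2 : ℤ) + 2 = 0 by norm_num, show (-2 : ℤ) + -2 = -4 by norm_num, axisVec_zero_right,
              axisVec_neg_eq_of_spInvariant hI, axisVec_eq_of_spInvariant hI ι i₀ 4]
            linarith
        · rw [if_neg hικ, add_zero]
          have hκι : κ ≠ ι := Ne.symm hικ
          have hpin : ∀ s : ℤ, |s| = 2 → F (axisVec κ a + axisVec ι s) ≤ f22 := fun s hs =>
            (le_axisVec_add_axisVec_of_absMonotone hF hκι 2 2 _
              (by rw [add_axisVec_apply_of_ne _ hκι, axisVec_apply', if_pos rfl, h2]; norm_num)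
              (by rw [add_axisVec_apply_self, axisVec_apply', if_neg hικ, zero_add, hs]; norm_num)).trans
              (axisVec_add_axisVec_eq_of_spInvariant hI hκι h01 2 2).le
          have ha' := hpin 2 (by norm_num)
          have hb' : F (axisVec κ a - axisVec ι 2) ≤ f22 := by
            rw [sub_axisVec_eq_add]; exact hpin (-2) (by norm_num)
          linarith
      refine le_max_of_le_left ((Finset.sum_le_sum fun ι _ => hterm ι).trans ?_)
      rw [sum_const_add_ite]
      linarith
    · -- `|a| ≥ 3`: no shifted point is the origin
      have hterm : ∀ ι : Fin d, F (axisVec κ a + axisVec ι 2) + F (axisVec κ a - axisVec ι 2) ≤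
          2 * f11 + (if ι = κ then 2 * (f1 - f11) else 0) := by
        intro ι
        by_cases hικ : ι = κ
        · subst hικ
          rw [if_pos rfl, sub_axisVec_eq_add, axisVec_add_axisVec_same, axisVec_add_axisVec_same]
          have hsh : ∀ s : ℤ, 1 ≤ |a + s| → F (axisVec ι (a + s)) ≤ f1 := fun s hs =>
            (le_axisVec_of_absMonotone hF ι 1 _ (by rw [axisVec_apply', if_pos rfl, abs_one]; exact hs)).trans
              (axisVec_eq_of_spInvariant hI ι i₀ 1).le
          have ha' := hsh 2 (by
            rcases le_abs.mp h3 with h | h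
            · exact le_abs.mpr (Or.inl (by omega))
            · exact le_abs.mpr (Or.inr (by omega)))
          have hb' := hsh (-2) (by
            rcases le_abs.mp h3 with h | h
            · exact le_abs.mpr (Or.inl (by omega))
            · exact le_abs.mpr (Or.inr (by omega)))
          linarith
        · rw [if_neg hικ, add_zero]
          have hκι : κ ≠ ι := Ne.symm hικ
          have hpin : ∀ s : ℤ, 1 ≤ |s| → F (axisVec κ a + axisVec ι s) ≤ f11 := fun s hs =>
            (le_axisVec_add_axisVec_of_absMonotone hF hκι 1 1 _
              (by rw [add_axisVec_apply_of_ne _ hκι, axisVec_apply', if_pos rfl, abs_one]; omega)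
              (by rw [add_axisVec_apply_self, axisVec_apply', if_neg hικ, zero_add, abs_one]; exact hs)).trans
              (axisVec_add_axisVec_eq_of_spInvariant hI hκι h01 1 1).le
          have ha' := hpin 2 (by norm_num)
          have hb' : F (axisVec κ a - axisVec ι 2) ≤ f11 := by
            rw [sub_axisVec_eq_add]; exact hpin (-2) (by norm_num)
          linarith
      refine le_max_of_le_right ((Finset.sum_le_sum fun ι _ => hterm ι).trans ?_)
      rw [sum_const_add_ite]
      have hd' : (2 : ℝ) ≤ d := by exact_mod_cast hd
      nlinarith [hf11_le]

/-- **`S_{p,l}` on the cell `‖x‖₁ ≥ 2`** (`p ≥ 1`, `d ≥ 2p+1`):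
`S_{p,l}(x) ≤ max (I(0) + I(4e₁) + (2d−2) I(2e₁+2e₂)) (4 I(e₁) + (2d−4) I(e₁+e₂))`, `I = I_{p,l}`.
[cite: FitznerVanDerHofstad2016NoBLE, Lemma 5.1 p. 1093; (3.30) p. 1070; §3.3.5 (3.87) p. 1079] -/
theorem srwIShift2_le_max_of_two_le_sum_abs {p : ℕ} (hp : 1 ≤ p) (hd : 2 * p + 1 ≤ d) (l : ℕ)
    (x : Fin d → ℤ) (hx : 2 ≤ ∑ j, |x j|) :
    srwIShift2 d p l x ≤
      max (srwI d p l 0 + srwI d p l (vecOfParts d [4]) + (2 * d - 2) * srwI d p l (vecOfParts d [2, 2]))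
        (4 * srwI d p l (vecOfParts d [1]) + (2 * d - 4) * srwI d p l (classVec d 2 0)) :=
  shift2Sum_le_max_of_two_le_sum_abs (absMonotone_srwI hp hd l) (spInvariant_srwI p l) (by omega) x hx

/-- **`S_{p,l}` on `𝒳`** (`𝒳 ⊆ {‖x‖₁ ≥ 2}`). [cite: FitznerVanDerHofstad2016NoBLE, Lemma 5.1 p. 1093; (3.30); §3.3.5 (3.87)] -/
theorem srwIShift2_le_max_of_mem_calX {p : ℕ} (hp : 1 ≤ p) (hd : 2 * p + 1 ≤ d) (l : ℕ)
    {x : Fin d → ℤ} (hx : x ∈ calX d) :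
    srwIShift2 d p l x ≤
      max (srwI d p l 0 + srwI d p l (vecOfParts d [4]) + (2 * d - 2) * srwI d p l (vecOfParts d [2, 2]))
        (4 * srwI d p l (vecOfParts d [1]) + (2 * d - 4) * srwI d p l (classVec d 2 0)) :=
  srwIShift2_le_max_of_two_le_sum_abs hp hd l x (two_le_sum_abs_of_mem_calX x hx)

/-- **Node-bound form on `𝒳`**: from the six node values, `S_{p,l}(x) ≤ B` for every `x ∈ 𝒳`.
[cite: FitznerVanDerHofstad2016NoBLE, Lemma 5.1 p. 1093; (3.30); §3.3.5 (3.87)] -/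
theorem srwIShift2_le_of_nodeBounds_calX {p : ℕ} (hp : 1 ≤ p) (hd : 2 * p + 1 ≤ d) (l : ℕ) {B : ℝ}
    (hA : srwI d p l 0 + srwI d p l (vecOfParts d [4]) + (2 * d - 2) * srwI d p l (vecOfParts d [2, 2]) ≤ B)
    (hB : 4 * srwI d p l (vecOfParts d [1]) + (2 * d - 4) * srwI d p l (classVec d 2 0) ≤ B)
    {x : Fin d → ℤ} (hx : x ∈ calX d) : srwIShift2 d p l x ≤ B :=
  (srwIShift2_le_max_of_mem_calX hp hd l hx).trans (max_le hA hB)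

/-- **`S_{p,l}(0) = 2d · I_{p,l}(2e₁)`** (every `p`, `l`; `d ≥ 1`). [cite: FitznerVanDerHofstad2016NoBLE, (3.30), (3.35)] -/
theorem srwIShift2_zero (p l : ℕ) (hd : 1 ≤ d) : srwIShift2 d p l 0 = 2 * d * srwI d p l (vecOfParts d [2]) :=
  shift2Sum_zero (spInvariant_srwI p l) hd

/-- Blanket bound `S_{p,l}(x) ≤ 2d · I_{p,l}(0)` (`p ≥ 1`, `d ≥ 2p+1`, every `x`). [cite: FitznerVanDerHofstad2016NoBLE, Lemma 5.1 p. 1093] -/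
theorem srwIShift2_le_srwI_zero_mul {p : ℕ} (hp : 1 ≤ p) (hd : 2 * p + 1 ≤ d) (l : ℕ) (x : Fin d → ℤ) :
    srwIShift2 d p l x ≤ 2 * d * srwI d p l 0 :=
  shift2Sum_le_card_mul (fun z => absMonotone_srwI hp hd l z 0 fun μ => by simp) x

end Literature.Probability.FitznerVanDerHofstad2017
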